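import Mathlib
import HarnessLib

/-!
# Contour integrals in the complex plane: the Birkhoff–Young five-point formula and the trapezoidal
# rule on a circle (Lyness–Delves coefficients) — Davis–Rabinowitz (1984) Sect. 2.11.1

P. J. Davis and P. Rabinowitz, *Methods of Numerical Integration*, 2nd ed., Academic Press 1984,
Sect. 2.11.1 "Contour Integrals in the Complex Plane", pp. 168–172, displays (2.11.1.2)–(2.11.1.3) and
(2.11.1.4)–(2.11.1.8).

THE TEXT. (i) Birkhoff–Young: for `f` analytic,
`∫_{z₀-h}^{z₀+h} f(z) dz = (h/15){24 f(z₀) + 4[f(z₀+h) + f(z₀-h)] - [f(z₀+ih) + f(z₀-ih)]} + R` (2.11.1.2)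
with `|R| ≤ (1/1890) |h|⁷ max_{z ∈ S} |f⁽⁶⁾(z)|`, `S` the square with vertices `z₀ + iᵏh` (2.11.1.3).
(ii) Lether's remark: a rule `∫_{-1}^{1} F = Σ A_k F(a_k) + E_n(F)` (2.11.1.4) transforms to the segment
`[z₀ - h, z₀ + h]` as `Σ w_k f(z_k)`, `w_k = h A_k`, `z_k = h a_k + z₀`, `R_n(f) = h E_n[f(hu + z₀)]` (2.11.1.5).
(iii) On the circle `|z| = r`: `I = (1/2πi) ∮_C f(z) dz = r ∫_0^1 e^{2πit} f(re^{2πit}) dt` (2.11.1.6) is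
integrated by the trapezoidal rule `I ≈ (r/N) Σ_{k=1}^{N} e^{2πik/N} f(re^{2πik/N})` (2.11.1.7), and the
Taylor coefficients `a_j = f⁽ʲ⁾(0)/j! = (1/2πi) ∮ f(z) z^{-j-1} dz` by
`ã_j = (1/(rʲN)) Σ_{k=1}^{N} f(re^{2πik/N}) e^{-2πijk/N}` (2.11.1.8), "exact for `f ∈ 𝒫_{N-1}` for
`j = 0, 1, …, N - 1`" (Lyness–Delves).

WHAT IS FORMALISED (polynomial / exactness content; the analytic remainder bound (2.11.1.3) for general
analytic `f` is NOT proved — only that its constant is attained):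
* `complexSegmentIntegral f z₀ h = ∫_{-1}^{1} f(z₀ + t h) h dt` — the segment integral in the parametrised form
  (2.11.1.5) (`complexSegmentIntegral_eq_mul_integral`), with `complexSegmentIntegral_sub_pow` (the monomial values
  `h^{k+1}(1 - (-1)^{k+1})/(k+1)`);
* `birkhoffYoung f z₀ h` — the right-hand side of (2.11.1.2); `birkhoffYoung_exact` — `R = 0` for every
  complex polynomial of degree `≤ 5` (via the Taylor expansion at `z₀`; odd powers `(z - z₀)^k` are
  integrated exactly for every `k`, `birkhoffYoung_sub_pow_odd`); `birkhoffYoung_defect_pow_six` — for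
  `f = (z - z₀)⁶`, `R = -(8/21) h⁷ = -(1/1890) h⁷ · f⁽⁶⁾` (`f⁽⁶⁾ ≡ 720`), so the constant `1/1890` of
  (2.11.1.3) is attained and the formula has precision exactly `5`;
* `circleTrapezoidal N r f` — the rule (2.11.1.7) (nodes indexed `k = 0, …, N - 1`, the same node set);
  `circleTrapezoidal_eq_zero` — it vanishes on every polynomial of degree `≤ N - 2`, which is the exact
  value `(1/2πi) ∮_{|z|=r} p(z) dz = 0` (`circleIntegral_polynomial_eq_zero`, Cauchy); and
  `circleTrapezoidal_pow_pred` — on `z^{N-1}` the rule returns `r^N ≠ 0` (aliasing: the integrand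
  `e^{iθ} f(re^{iθ})` then has frequency `N`, cf. (2.9.20)), so the exactness range of (2.11.1.7) is
  `𝒫_{N-2}` — the text's "`𝒫_{N-1}`" at this point must be read with `deg f < N - 1`;
* `lynessDelvesCoeff N r f j` — `ã_j` of (2.11.1.8); `lynessDelvesCoeff_eq_coeff` — `ã_j = a_j`
  (`= p.coeff j`, the Taylor coefficient at `0` of a polynomial) for `deg p ≤ N - 1`, `j ≤ N - 1`, `r ≠ 0`,
  exactly as stated in the text; the engine behind both is the roots-of-unity sum
  `Σ_{k<N} e^{2πink/N} = N·[N ∣ n]`.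
-/

namespace Literature.Analysis.Quadrature

open Complex Finset Polynomial intervalIntegral

noncomputable section

/-! ## The segment `[z₀ - h, z₀ + h]` and the Birkhoff–Young formula, (2.11.1.2)–(2.11.1.5) -/

/-- The complex segment integral `∫_{z₀-h}^{z₀+h} f(z) dz`, parametrised linearly:
`∫_{-1}^{1} f(z₀ + t h) h dt` (the transformation (2.11.1.4)–(2.11.1.5) of a rule on `[-1, 1]` to the
segment: `w_k = h A_k`, `z_k = h a_k + z₀`). [cite: DavisRabinowitz1984, Sect. 2.11.1 (2.11.1.5)] -/
def complexSegmentIntegral (f : ℂ → ℂ) (z₀ h : ℂ) : ℂ := ∫ t in (-1:ℝ)..1, h * f (z₀ + t * h)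

/-- (2.11.1.5): `∫_{z₀-h}^{z₀+h} f(z) dz = h ∫_{-1}^{1} f(hu + z₀) du`.
[cite: DavisRabinowitz1984, Sect. 2.11.1 (2.11.1.5)] -/
theorem complexSegmentIntegral_eq_mul_integral (f : ℂ → ℂ) (z₀ h : ℂ) :
    complexSegmentIntegral f z₀ h = h * ∫ u in (-1:ℝ)..1, f (h * u + z₀) := by
  unfold complexSegmentIntegral
  rw [← intervalIntegral.integral_const_mul]
  refine intervalIntegral.integral_congr fun u _ => ?_
  simp only [show z₀ + (u : ℂ) * h = h * u + z₀ by ring]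

/-- The segment integral of a centred power: `∫_{z₀-h}^{z₀+h} (z - z₀)^k dz = h^{k+1}(1 - (-1)^{k+1})/(k+1)`.
[cite: DavisRabinowitz1984, Sect. 2.11.1 (2.11.1.5)] -/
theorem complexSegmentIntegral_sub_pow (z₀ h : ℂ) (k : ℕ) :
    complexSegmentIntegral (fun z => (z - z₀) ^ k) z₀ h
      = h ^ (k + 1) * (1 - (-1) ^ (k + 1)) / (k + 1) := by
  unfold complexSegmentIntegral
  have hk : ∀ t : ℝ, h * (z₀ + t * h - z₀) ^ k = h ^ (k + 1) * ((t ^ k : ℝ) : ℂ) := by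
    intro t; push_cast; ring
  simp_rw [hk]
  rw [intervalIntegral.integral_const_mul, intervalIntegral.integral_ofReal, integral_pow]
  push_cast
  ring

/-- Additivity of the segment integral (for interval-integrable parametrisations). [cite: DavisRabinowitz1984, Sect. 2.11.1 (2.11.1.5)] -/
theorem complexSegmentIntegral_add {f g : ℂ → ℂ} {z₀ h : ℂ}
    (hf : IntervalIntegrable (fun t : ℝ => h * f (z₀ + t * h)) MeasureTheory.volume (-1) 1)
    (hg : IntervalIntegrable (fun t : ℝ => h * g (z₀ + t * h)) MeasureTheory.volume (-1) 1) :
    complexSegmentIntegral (fun z => f z + g z) z₀ h = complexSegmentIntegral f z₀ h + complexSegmentIntegral g z₀ h := by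
  unfold complexSegmentIntegral
  rw [← intervalIntegral.integral_add hf hg]
  refine intervalIntegral.integral_congr fun t _ => ?_
  simp only; ring

/-- The Birkhoff–Young five-point formula (2.11.1.2) (right-hand side without the remainder):
`(h/15){24 f(z₀) + 4[f(z₀+h) + f(z₀-h)] - [f(z₀+ih) + f(z₀-ih)]}`.
[cite: DavisRabinowitz1984, Sect. 2.11.1 (2.11.1.2)] -/
def birkhoffYoung (f : ℂ → ℂ) (z₀ h : ℂ) : ℂ :=
  h / 15 * (24 * f z₀ + 4 * (f (z₀ + h) + f (z₀ - h)) - (f (z₀ + I * h) + f (z₀ - I * h)))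

/-- Linearity of the Birkhoff–Young functional: sums. [cite: DavisRabinowitz1984, Sect. 2.11.1 (2.11.1.2)] -/
theorem birkhoffYoung_add (f g : ℂ → ℂ) (z₀ h : ℂ) :
    birkhoffYoung (fun z => f z + g z) z₀ h = birkhoffYoung f z₀ h + birkhoffYoung g z₀ h := by
  unfold birkhoffYoung; ring

/-- Linearity of the Birkhoff–Young functional: scalars. [cite: DavisRabinowitz1984, Sect. 2.11.1 (2.11.1.2)] -/
theorem birkhoffYoung_const_mul (c : ℂ) (f : ℂ → ℂ) (z₀ h : ℂ) :
    birkhoffYoung (fun z => c * f z) z₀ h = c * birkhoffYoung f z₀ h := by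
  unfold birkhoffYoung; ring

/-- Linearity of the Birkhoff–Young functional: finite sums. [cite: DavisRabinowitz1984, Sect. 2.11.1 (2.11.1.2)] -/
theorem birkhoffYoung_finset_sum {ι : Type*} (s : Finset ι) (g : ι → ℂ → ℂ) (z₀ h : ℂ) :
    birkhoffYoung (fun z => ∑ i ∈ s, g i z) z₀ h = ∑ i ∈ s, birkhoffYoung (g i) z₀ h := by
  classical
  induction s using Finset.induction_on with
  | empty => simp [birkhoffYoung]
  | insert a s ha ih =>
    simp_rw [Finset.sum_insert ha]
    rw [← ih, ← birkhoffYoung_add]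

/-- The Birkhoff–Young value on a centred power:
`BY[(z - z₀)^k] = (h/15)(24·0^k + 4(h^k + (-h)^k) - ((ih)^k + (-ih)^k))`. [cite: DavisRabinowitz1984, Sect. 2.11.1 (2.11.1.2)] -/
theorem birkhoffYoung_sub_pow (z₀ h : ℂ) (k : ℕ) :
    birkhoffYoung (fun z => (z - z₀) ^ k) z₀ h
      = h / 15 * (24 * (0:ℂ) ^ k + 4 * (h ^ k + (-h) ^ k) - ((I * h) ^ k + (-(I * h)) ^ k)) := by
  unfold birkhoffYoung
  ring_nf

/-- **Odd powers are integrated exactly by (2.11.1.2)** (for every degree): for odd `k`,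
`∫_{z₀-h}^{z₀+h} (z - z₀)^k dz = 0 = BY[(z - z₀)^k]`. [cite: DavisRabinowitz1984, Sect. 2.11.1 (2.11.1.2)] -/
theorem birkhoffYoung_sub_pow_odd (z₀ h : ℂ) {k : ℕ} (hk : Odd k) :
    complexSegmentIntegral (fun z => (z - z₀) ^ k) z₀ h = 0
      ∧ birkhoffYoung (fun z => (z - z₀) ^ k) z₀ h = 0 := by
  have hk1 : Even (k + 1) := hk.add_one
  refine ⟨?_, ?_⟩
  · rw [complexSegmentIntegral_sub_pow, hk1.neg_one_pow]; ring
  · rw [birkhoffYoung_sub_pow, hk.neg_pow, hk.neg_pow, zero_pow hk.pos.ne']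
    ring

/-- **Even powers up to degree 4 are integrated exactly by (2.11.1.2)**:
`∫ (z - z₀)^{2m} dz = 2h^{2m+1}/(2m+1) = BY[(z - z₀)^{2m}]` for `m ≤ 2`.
[cite: DavisRabinowitz1984, Sect. 2.11.1 (2.11.1.2)] -/
theorem birkhoffYoung_sub_pow_even (z₀ h : ℂ) {m : ℕ} (hm : m ≤ 2) :
    complexSegmentIntegral (fun z => (z - z₀) ^ (2 * m)) z₀ h
      = birkhoffYoung (fun z => (z - z₀) ^ (2 * m)) z₀ h := by
  rw [complexSegmentIntegral_sub_pow, birkhoffYoung_sub_pow]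
  have hI : (I * h) ^ (2 * m) = (-1) ^ m * h ^ (2 * m) := by
    rw [mul_pow, pow_mul, I_sq]
  have hI' : (-(I * h)) ^ (2 * m) = (-1) ^ m * h ^ (2 * m) := by
    rw [(even_two_mul m).neg_pow, hI]
  have hh : (-h) ^ (2 * m) = h ^ (2 * m) := (even_two_mul m).neg_pow h
  have h1 : ((-1 : ℂ)) ^ (2 * m + 1) = -1 := by
    rw [pow_succ, (even_two_mul m).neg_one_pow, one_mul]
  rw [hI, hI', hh, h1]
  interval_cases m <;> push_cast <;> ring

/-- **The Birkhoff–Young formula (2.11.1.2) is exact for complex polynomials of degree `≤ 5`**: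
`∫_{z₀-h}^{z₀+h} p(z) dz = (h/15){24 p(z₀) + 4[p(z₀+h) + p(z₀-h)] - [p(z₀+ih) + p(z₀-ih)]}`.
[cite: DavisRabinowitz1984, Sect. 2.11.1 (2.11.1.2)] -/
theorem birkhoffYoung_exact (p : ℂ[X]) (hp : p.natDegree ≤ 5) (z₀ h : ℂ) :
    complexSegmentIntegral (fun z => p.eval z) z₀ h = birkhoffYoung (fun z => p.eval z) z₀ h := by
  -- Taylor expansion at `z₀`: `p(z) = Σ_{k<6} c_k (z - z₀)^k`, `c_k = (taylor z₀ p).coeff k`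
  set q := taylor z₀ p with hq
  have hqdeg : q.natDegree < 6 := by rw [hq, natDegree_taylor]; omega
  have hexp : ∀ z : ℂ, p.eval z = ∑ k ∈ range 6, q.coeff k * (z - z₀) ^ k := by
    intro z
    have h1 : p.eval z = q.eval (z - z₀) := by rw [hq, taylor_eval]; ring_nf
    rw [h1]
    conv_lhs => rw [q.as_sum_range' 6 hqdeg]
    simp [eval_finsetSum]
  simp_rw [hexp]
  rw [birkhoffYoung_finset_sum]
  -- the segment integral of the finite sum, term by term
  have hint : ∀ k : ℕ, IntervalIntegrable (fun t : ℝ => h * (q.coeff k * (z₀ + t * h - z₀) ^ k))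
      MeasureTheory.volume (-1) 1 := fun k =>
    (by fun_prop : Continuous fun t : ℝ => h * (q.coeff k * (z₀ + t * h - z₀) ^ k)).intervalIntegrable _ _
  have hsum : complexSegmentIntegral (fun z => ∑ k ∈ range 6, q.coeff k * (z - z₀) ^ k) z₀ h
      = ∑ k ∈ range 6, complexSegmentIntegral (fun z => q.coeff k * (z - z₀) ^ k) z₀ h := by
    unfold complexSegmentIntegral
    rw [← intervalIntegral.integral_finsetSum fun k _ => hint k]
    refine intervalIntegral.integral_congr fun t _ => ?_
    simp only [mul_sum]
  rw [hsum]
  refine sum_congr rfl fun k hk => ?_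
  have hk6 : k < 6 := mem_range.mp hk
  -- pull out the coefficient and use the monomial statements
  have hsmul : complexSegmentIntegral (fun z => q.coeff k * (z - z₀) ^ k) z₀ h
      = q.coeff k * complexSegmentIntegral (fun z => (z - z₀) ^ k) z₀ h := by
    unfold complexSegmentIntegral
    rw [← intervalIntegral.integral_const_mul]
    refine intervalIntegral.integral_congr fun t _ => ?_
    simp only; ring
  rw [hsmul, birkhoffYoung_const_mul]
  congr 1
  rcases Nat.even_or_odd k with ⟨m, hm⟩ | hodd
  · have hm' : k = 2 * m := by omega
    subst hm'
    exact birkhoffYoung_sub_pow_even z₀ h (by omega)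
  · obtain ⟨h1, h2⟩ := birkhoffYoung_sub_pow_odd z₀ h hodd
    rw [h1, h2]

/-- **The constant of (2.11.1.3) is attained at degree 6**: for `f(z) = (z - z₀)⁶`,
`R = ∫_{z₀-h}^{z₀+h} f - BY[f] = 2h⁷/7 - 2h⁷/3 = -(8/21) h⁷`; in particular the formula has
precision exactly `5`. [cite: DavisRabinowitz1984, Sect. 2.11.1 (2.11.1.2)-(2.11.1.3)] -/
theorem birkhoffYoung_defect_pow_six (z₀ h : ℂ) :
    complexSegmentIntegral (fun z => (z - z₀) ^ 6) z₀ h - birkhoffYoung (fun z => (z - z₀) ^ 6) z₀ h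
      = -(8 / 21) * h ^ 7 := by
  rw [complexSegmentIntegral_sub_pow, birkhoffYoung_sub_pow]
  have hI : (I * h) ^ 6 = -h ^ 6 := by
    rw [mul_pow, show (6:ℕ) = 2 * 3 from rfl, pow_mul, I_sq]; ring
  have hI' : (-(I * h)) ^ 6 = -h ^ 6 := by rw [(by decide : Even 6).neg_pow, hI]
  rw [hI, hI']
  push_cast
  ring

/-- Iterated derivatives of a polynomial function are the evaluations of the iterated formal
derivative. [folklore] -/
private theorem iteratedDeriv_eval_poly (p : ℂ[X]) (m : ℕ) (x : ℂ) :
    iteratedDeriv m (fun y => p.eval y) x = (derivative^[m] p).eval x := by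
  induction m generalizing x with
  | zero => simp
  | succ m ih =>
    rw [iteratedDeriv_succ, Function.iterate_succ_apply']
    have : iteratedDeriv m (fun y => p.eval y) = fun y => (derivative^[m] p).eval y := funext ih
    rw [this, Polynomial.deriv]

/-- The sixth derivative of `(z - z₀)⁶` is the constant `720 = 6!`. [folklore] -/
private theorem iteratedDeriv_six_sub_pow_six (z₀ z : ℂ) :
    iteratedDeriv 6 (fun w => (w - z₀) ^ 6) z = 720 := by
  have h := iteratedDeriv_eval_poly ((X - C z₀) ^ 6) 6 z
  simp only [eval_pow, eval_sub, eval_X, eval_C] at h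
  rw [h, iterate_derivative_X_sub_pow]
  norm_num [Nat.descFactorial]

/-- **(2.11.1.3), sharpness**: for `f(z) = (z - z₀)⁶` the remainder of (2.11.1.2) is
`R = -(1/1890) h⁷ f⁽⁶⁾` with `f⁽⁶⁾ ≡ 720` constant on the square `S`, so `|R| = (1/1890)|h|⁷ max_S |f⁽⁶⁾|`
— the printed constant `1/1890` cannot be improved. [cite: DavisRabinowitz1984, Sect. 2.11.1 (2.11.1.3)] -/
theorem birkhoffYoung_defect_eq_errorTerm (z₀ h z : ℂ) :
    complexSegmentIntegral (fun w => (w - z₀) ^ 6) z₀ h - birkhoffYoung (fun w => (w - z₀) ^ 6) z₀ h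
      = -(1 / 1890) * h ^ 7 * iteratedDeriv 6 (fun w => (w - z₀) ^ 6) z := by
  rw [birkhoffYoung_defect_pow_six, iteratedDeriv_six_sub_pow_six]
  ring

/-- Norm form of the sharpness statement: `‖R‖ = (1/1890) ‖h‖⁷ · 720`. [cite: DavisRabinowitz1984, Sect. 2.11.1 (2.11.1.3)] -/
theorem norm_birkhoffYoung_defect_pow_six (z₀ h : ℂ) :
    ‖complexSegmentIntegral (fun w => (w - z₀) ^ 6) z₀ h - birkhoffYoung (fun w => (w - z₀) ^ 6) z₀ h‖
      = 1 / 1890 * ‖h‖ ^ 7 * 720 := by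
  rw [birkhoffYoung_defect_pow_six, norm_mul, norm_neg, norm_pow]
  norm_num; ring

/-! ## Roots-of-unity node sums (the engine of (2.11.1.7)–(2.11.1.8)) -/

/-- `Σ_{k<N} e^{2πi n k/N} = N` if `N ∣ n`, else `0` (`n ∈ ℤ`). [folklore] -/
private theorem sum_cexp_two_pi_mul_div {N : ℕ} (hN : N ≠ 0) (n : ℤ) :
    ∑ k ∈ range N, cexp (2 * Real.pi * I * n * k / N) = if (N : ℤ) ∣ n then (N : ℂ) else 0 := by
  have hNc : (N : ℂ) ≠ 0 := by exact_mod_cast hN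
  set ζ := cexp (2 * Real.pi * I / N) with hζ
  have hprim : IsPrimitiveRoot ζ N := Complex.isPrimitiveRoot_exp N hN
  have hpow : ∀ k : ℕ, cexp (2 * Real.pi * I * n * k / N) = (ζ ^ n) ^ k := by
    intro k
    rw [hζ, ← Complex.exp_int_mul, ← Complex.exp_nat_mul]
    congr 1
    field_simp
  simp_rw [hpow]
  split_ifs with hdvd
  · have h1 : ζ ^ n = 1 := by
      obtain ⟨m, hm⟩ := hdvd
      rw [hm, zpow_mul, zpow_natCast, hprim.pow_eq_one, one_zpow]
    simp [h1]
  · have h1 : ζ ^ n ≠ 1 := by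
      intro h
      apply hdvd
      exact (hprim.zpow_eq_one_iff_dvd n).mp h
    rw [geom_sum_eq h1, ← zpow_natCast, ← zpow_mul, mul_comm, zpow_mul, zpow_natCast,
      hprim.pow_eq_one, one_zpow, sub_self, zero_div]

/-! ## The trapezoidal rule on the circle `|z| = r`, (2.11.1.6)–(2.11.1.8) -/

/-- The `N`-point trapezoidal rule for `I = (1/2πi) ∮_{|z|=r} f(z) dz = r ∫_0^1 e^{2πit} f(re^{2πit}) dt`:
`(r/N) Σ_k e^{2πik/N} f(r e^{2πik/N})` ((2.11.1.7); the text sums `k = 1, …, N`, the same node set as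
`k = 0, …, N - 1`). [cite: DavisRabinowitz1984, Sect. 2.11.1 (2.11.1.7)] -/
def circleTrapezoidal (N : ℕ) (r : ℝ) (f : ℂ → ℂ) : ℂ :=
  (r / N : ℂ) * ∑ k ∈ range N, cexp (2 * Real.pi * I * k / N) * f (r * cexp (2 * Real.pi * I * k / N))

/-- The Lyness–Delves approximation to the Taylor coefficient `a_j = f⁽ʲ⁾(0)/j!`:
`ã_j = (1/(rʲ N)) Σ_k f(r e^{2πik/N}) e^{-2πijk/N}` (2.11.1.8) (nodes `k = 0, …, N - 1`).
[cite: DavisRabinowitz1984, Sect. 2.11.1 (2.11.1.8)] -/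
def lynessDelvesCoeff (N : ℕ) (r : ℝ) (f : ℂ → ℂ) (j : ℕ) : ℂ :=
  (1 / ((r : ℂ) ^ j * N)) * ∑ k ∈ range N,
    f (r * cexp (2 * Real.pi * I * k / N)) * cexp (-(2 * Real.pi * I * j * k / N))

/-- The node values of a power: `(r e^{2πik/N})^m = r^m e^{2πimk/N}`. [folklore] -/
private theorem node_pow (N : ℕ) (r : ℝ) (k m : ℕ) :
    ((r : ℂ) * cexp (2 * Real.pi * I * k / N)) ^ m
      = (r : ℂ) ^ m * cexp (2 * Real.pi * I * m * k / N) := by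
  rw [mul_pow, ← Complex.exp_nat_mul]
  congr 2
  ring

/-- Discrete orthogonality on the `N`-th roots of unity: for `m, j < N`,
`Σ_{k<N} e^{2πimk/N} e^{-2πijk/N} = N [m = j]`. [folklore] -/
private theorem sum_cexp_mul_cexp_neg {N m j : ℕ} (hm : m < N) (hj : j < N) :
    ∑ k ∈ range N, cexp (2 * Real.pi * I * m * k / N) * cexp (-(2 * Real.pi * I * j * k / N))
      = if m = j then (N : ℂ) else 0 := by
  have hN : N ≠ 0 := by omega
  have hterm : ∀ k : ℕ, cexp (2 * Real.pi * I * m * k / N) * cexp (-(2 * Real.pi * I * j * k / N))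
      = cexp (2 * Real.pi * I * ((m : ℤ) - j : ℤ) * k / N) := by
    intro k
    rw [← Complex.exp_add]
    push_cast
    ring_nf
  simp_rw [hterm, sum_cexp_two_pi_mul_div hN]
  by_cases hmj : m = j
  · subst hmj; simp
  · rw [if_neg hmj, if_neg]
    intro hdvd
    have := Int.eq_zero_of_dvd_of_natAbs_lt_natAbs hdvd (by omega)
    omega

/-- **(2.11.1.8) is exact for polynomials of degree `≤ N - 1`** (Lyness–Delves): for `p ∈ 𝒫_{N-1}`,
`j ≤ N - 1` and `r ≠ 0`, `ã_j = a_j`, the `j`-th (Taylor) coefficient of `p`.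
[cite: DavisRabinowitz1984, Sect. 2.11.1 (2.11.1.8)] -/
theorem lynessDelvesCoeff_eq_coeff {N : ℕ} (p : ℂ[X]) (hp : p.natDegree < N) {j : ℕ} (hj : j < N)
    {r : ℝ} (hr : r ≠ 0) :
    lynessDelvesCoeff N r (fun z => p.eval z) j = p.coeff j := by
  have hN : N ≠ 0 := by omega
  have hNc : (N : ℂ) ≠ 0 := by exact_mod_cast hN
  have hrc : (r : ℂ) ≠ 0 := by exact_mod_cast hr
  have hexp : ∀ z : ℂ, p.eval z = ∑ m ∈ range N, p.coeff m * z ^ m := by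
    intro z
    conv_lhs => rw [p.as_sum_range' N hp]
    simp [eval_finsetSum]
  unfold lynessDelvesCoeff
  simp_rw [hexp, node_pow, sum_mul]
  rw [sum_comm]
  have hin : ∀ m ∈ range N, ∑ k ∈ range N,
      p.coeff m * ((r : ℂ) ^ m * cexp (2 * Real.pi * I * m * k / N))
        * cexp (-(2 * Real.pi * I * j * k / N))
      = if m = j then p.coeff j * (r : ℂ) ^ j * N else 0 := by
    intro m hm
    have h := sum_cexp_mul_cexp_neg (mem_range.mp hm) hj
    have : ∀ k : ℕ, p.coeff m * ((r : ℂ) ^ m * cexp (2 * Real.pi * I * m * k / N))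
          * cexp (-(2 * Real.pi * I * j * k / N))
        = p.coeff m * (r : ℂ) ^ m * (cexp (2 * Real.pi * I * m * k / N)
          * cexp (-(2 * Real.pi * I * j * k / N))) := fun k => by ring
    simp_rw [this, ← mul_sum, h]
    split_ifs with hmj
    · subst hmj; ring
    · simp
  rw [sum_congr rfl hin, sum_ite_eq' (range N) j, if_pos (mem_range.mpr hj)]
  field_simp

/-- **Exactness range of the circle rule (2.11.1.7)**: it vanishes on every polynomial of degree
`≤ N - 2` — which is the exact value `(1/2πi) ∮_{|z|=r} p(z) dz = 0`
(`circleIntegral_polynomial_eq_zero`). [cite: DavisRabinowitz1984, Sect. 2.11.1 (2.11.1.7)] -/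
theorem circleTrapezoidal_eq_zero {N : ℕ} (p : ℂ[X]) (hp : p.natDegree + 2 ≤ N) (r : ℝ) :
    circleTrapezoidal N r (fun z => p.eval z) = 0 := by
  have hN : N ≠ 0 := by omega
  have hexp : ∀ z : ℂ, p.eval z = ∑ m ∈ range (N - 1), p.coeff m * z ^ m := by
    intro z
    conv_lhs => rw [p.as_sum_range' (N - 1) (by omega)]
    simp [eval_finsetSum]
  unfold circleTrapezoidal
  simp_rw [hexp, node_pow, mul_sum]
  rw [sum_comm]
  have hin : ∀ m ∈ range (N - 1), ∑ k ∈ range N, (r / N : ℂ) *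
      (cexp (2 * Real.pi * I * k / N) * (p.coeff m * ((r : ℂ) ^ m * cexp (2 * Real.pi * I * m * k / N))))
        = 0 := by
    intro m hm
    have hmN : m + 1 < N := by have := mem_range.mp hm; omega
    have : ∀ k : ℕ, (r / N : ℂ) * (cexp (2 * Real.pi * I * k / N)
          * (p.coeff m * ((r : ℂ) ^ m * cexp (2 * Real.pi * I * m * k / N))))
        = (r / N : ℂ) * p.coeff m * (r : ℂ) ^ m
            * cexp (2 * Real.pi * I * ((m + 1 : ℕ) : ℤ) * k / N) := by
      intro k
      rw [show (r / N : ℂ) * (cexp (2 * Real.pi * I * k / N)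
            * (p.coeff m * ((r : ℂ) ^ m * cexp (2 * Real.pi * I * m * k / N))))
          = (r / N : ℂ) * p.coeff m * (r : ℂ) ^ m
            * (cexp (2 * Real.pi * I * k / N) * cexp (2 * Real.pi * I * m * k / N)) by ring,
        ← Complex.exp_add]
      congr 2
      push_cast
      ring
    simp_rw [this, ← mul_sum, sum_cexp_two_pi_mul_div hN, Int.natCast_dvd_natCast]
    rw [if_neg (Nat.not_dvd_of_pos_of_lt (by omega) hmN), mul_zero]
  exact sum_eq_zero hin

/-- The exact value in (2.11.1.6)–(2.11.1.7) for a polynomial: `∮_{|z|=r} p(z) dz = 0` (Cauchy).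
[folklore] -/
private theorem circleIntegral_polynomial_eq_zero (p : ℂ[X]) {r : ℝ} (hr : 0 ≤ r) :
    (∮ z in C(0, r), p.eval z) = 0 :=
  Complex.circleIntegral_eq_zero_of_differentiable_on_off_countable hr Set.countable_empty
    (p.continuous.continuousOn) (fun _ _ => p.differentiable.differentiableAt)

/-- **Aliasing defect of (2.11.1.7) at degree `N - 1`**: on `f(z) = z^{N-1}` the rule returns `r^N`
(while `(1/2πi) ∮ z^{N-1} dz = 0`), so the rule is exact on `𝒫_{N-2}` and not on `𝒫_{N-1}`
(the integrand `e^{iθ} f(re^{iθ})` has frequency `N`; cf. (2.9.20)).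
[cite: DavisRabinowitz1984, Sect. 2.11.1 (2.11.1.7)] -/
theorem circleTrapezoidal_pow_pred {N : ℕ} (hN : N ≠ 0) (r : ℝ) :
    circleTrapezoidal N r (fun z => z ^ (N - 1)) = (r : ℂ) ^ N := by
  have hNc : (N : ℂ) ≠ 0 := by exact_mod_cast hN
  unfold circleTrapezoidal
  have hk : ∀ k ∈ range N, cexp (2 * Real.pi * I * k / N) * ((r : ℂ) * cexp (2 * Real.pi * I * k / N)) ^ (N - 1)
      = (r : ℂ) ^ (N - 1) := by
    intro k _
    rw [node_pow, mul_left_comm, ← Complex.exp_add]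
    have : 2 * Real.pi * I * k / N + 2 * Real.pi * I * ((N - 1 : ℕ) : ℂ) * k / N
        = k * (2 * Real.pi * I) := by
      rw [Nat.cast_sub (Nat.one_le_iff_ne_zero.mpr hN), Nat.cast_one]
      field_simp
      ring
    rw [this, Complex.exp_nat_mul_two_pi_mul_I, mul_one]
  rw [sum_congr rfl hk, sum_const, card_range, nsmul_eq_mul]
  have h1 : N - 1 + 1 = N := Nat.sub_add_cancel (Nat.one_le_iff_ne_zero.mpr hN)
  calc (r / N : ℂ) * (N * (r : ℂ) ^ (N - 1)) = r * (r : ℂ) ^ (N - 1) := by field_simp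
    _ = (r : ℂ) ^ N := by rw [← pow_succ', h1]

end

end Literature.Analysis.Quadrature
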